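import Summits.BirchSwinnertonDyer.BirchSwinnertonDyer.Theorems.ManinLocalTwoThreeKummerValuesRationalTwoTorsion
import Summits.BirchSwinnertonDyer.BirchSwinnertonDyer.Theorems.ManinLocalTwoThreeShimuraQuotientLevelInstances
import Literature.NumberTheory.EllipticCurves.LatticeInclusionIsogenyComplexPointsProofs
import Literature.NumberTheory.GaloisRepresentations.AbsGaloisGroup
import Summits.BirchSwinnertonDyer.BirchSwinnertonDyer.Theorems.ManinLocalTwoThreeShimuraQuotientConjugation
import Literature.NumberTheory.EllipticCurves.EichlerShimuraConstructionKernelProofs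
import Literature.NumberTheory.EllipticCurves.PAdicLFunctionProofs
import HarnessLib

/-!
# The Kummer values in the HALF-INDEX world `Λ₁(f) ⊆ 2Λ₀(f)`: `2⁵ ∣ N`, the Frey-twist shape, and `Λ₁(f) ⊄ 2Λ₀(f)` — fact-free in `hKum`
(route `ManinLocalTwoThree`, crux C2 `ManinOddAtFour` stmt-BirchSwinnertonDyer-22967; cell bsd-f2-manin, prover seat p3 gen 20;
`--supports stmt-BirchSwinnertonDyer-22967`; sequel of `…KummerValuesRationalTwoTorsion` (p3 gen 20) for es g40's §61 (B) «THEOREM K BEYOND INDEX 4»)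

es g40 (MEMO-es §61 (B)) weakens the index-`4` hypothesis `Λ₁(f) = 2Λ₀(f)` of E-es-185 to the HALF-INDEX hypothesis `Λ₁(f) ⊆ 2Λ₀(f)`
(⟺ the `2`-Sylow of `Λ₀/Λ₁ ≅ ker(E₁ → E₀)` is non-cyclic), obtains THEOREM K's conclusion there (KDR½, verbatim the Kummer values `hKum`) from
printed facts, and types E-es-187 `HalfIndexForcesFreyTwistShape` = «LEAD/p2 Steps 1–4 with `h4 ↦ hhalf`», whence E-es-188 `Λ₁(f) ⊄ 2Λ₀(f)` at
every level (the `2`-part of Stevens' cyclicity, desc g26 `Gamma1PeriodsNotInsideTwiceGamma0Periods`).  THIS FILE is the fact-free assembly those rows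
need, WITHOUT re-running Steps 1–4: the only use of `h4` in the LEAD/p2 assembly is its forward direction, inside PROPOSITION A's two vanishing inputs
(`w₀(γ) = 0` for `d_γ ≡ 1 (N)` and for `d_γ ≡ ±1 (M(N))`), and PROPOSITION A's FIRST conclusion is `2⁵ ∣ N` — which with Ling–Oesterlé's
`2Λ₀(f) ⊆ Λ₁(f)` at `4 ∣ N` (tree `two_mul_mem_periodLatticeGamma1_of_four_dvd`) turns the half-index hypothesis back into the index-`4` one.

* §1 `uniformize_half_cuspSymbol_eq_zero_of_halfIndex` and `two_pow_five_dvd_of_halfIndex_of_kummerValues` — PROPOSITION A (p2's abstract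
  `StepTwo.propositionA`) run in the half-index world with the Kummer values `hKum` as the only non-elementary input: `2⁵ ∣ N` (the odd class is the
  halving cocycle of `T₁`, LEAD D4; the three rational `2`-torsion abscissae come from `hKum` by `exists_three_hasRationalTwoTorsionX_of_kummerValues`).
* §2 `two_pow_five_dvd_and_hasFreyTwistShape_of_halfIndex_of_kummerValues` — E-es-187♭ per datum: half-index ∧ `hKum` ⟹ `2⁵ ∣ N` ∧ Frey-twist
  shape (fact-free); `not_halfIndex_of_modularity_of_kummerValues` — E-es-188♭ per datum: with modularity (Tate's family C at `2`, E-es-186♭) the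
  half-index configuration is IMPOSSIBLE for a lattice-optimal datum carrying the Kummer values.

HONEST FRAMING: unconditional kernel theorems about the hypothesis `hKum`; in the half-index world `hKum` itself is es g40's KDR½ (modulo printed facts:
a Shimura-cover equivariance fact ∧ T-es-75 ∧ CES, or T-es-75 for non-optimal `X₁(N)`-data on p2's datum `exists_gamma1ParametrizationData_of_smul_le`)
— NOT supplied here.  C2 `ManinOddAtFour`, E-es-187/188, Manin's conjecture and BSD are NOT proved by this file.  No definitions, no sorry.
[cite: Stevens1982, §1.3 Thm. 1.3.1 (b)] [cite: Stevens1989, §2] [cite: LingOesterle1991, Thm. 2] [cite: SilvermanAEC2009, Prop. X.1.4]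
-/

set_option autoImplicit false
-- lint-debt: the directory name repeats the summit name (sibling precedent `ManinLocalTwoThreeKummerValuesRationalTwoTorsion.lean`)
set_option linter.dupNamespace false

noncomputable section

open scoped Classical MatrixGroups
open Complex CongruenceSubgroup WeierstrassCurve WeierstrassCurve.Affine WeierstrassCurve.Affine.Point
open Literature.NumberTheory.EllipticCurves Literature.NumberTheory.EllipticCurves.ModularForms
open Literature.NumberTheory.EllipticCurves.Greenberg1999 Literature.NumberTheory.Automorphic
open Summit.BirchSwinnertonDyer.Rank1Residual.ManinAdditive.KummerDiamond
open Summit.BirchSwinnertonDyer.BirchSwinnertonDyer.Theorems.ManinLocalTwoThree.KummerDiamondIndexFour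

namespace Summit.BirchSwinnertonDyer.BirchSwinnertonDyer.Theorems.ManinLocalTwoThree.KummerValues

variable {W₀ : WeierstrassCurve ℚ} {N : ℕ} [NeZero N] (D₀ : ModularParametrizationData W₀ N)

/-! ## §1 PROPOSITION A in the half-index world: `2⁵ ∣ N` from the Kummer values -/

/-- In the half-index world `Λ₁(f) ⊆ 2Λ₀(f)`: `{∞,γ∞}_f ∈ Λ₁(f) ⟹ w₀(γ) = π₀(c₀{∞,γ∞}_f/2) = 0` (p2's
`uniformize_half_cuspSymbol_eq_zero_of_mem_periodLatticeGamma1` with `h4 ↦ hhalf`; only the forward direction of `h4` was ever used). [cite: Stevens1989, §2] -/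
theorem uniformize_half_cuspSymbol_eq_zero_of_halfIndex
    (hhalf : ∀ z ∈ periodLatticeGamma1 D₀.f, ∃ w ∈ periodLattice D₀.f, z = 2 * w) {γ : Gamma0 N}
    (hγ : cuspSymbol D₀.f γ ∈ periodLatticeGamma1 D₀.f) : D₀.uniformize ((D₀.c : ℂ) * cuspSymbol D₀.f γ / 2) = 0 := by
  obtain ⟨w, hw, he⟩ := hhalf _ hγ
  rw [he, show (D₀.c : ℂ) * (2 * w) / 2 = (D₀.c : ℂ) * w by ring, D₀.uniformize_eq_zero_iff]
  exact D₀.smul_periodLattice_le _ hw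

/-- **`2⁵ ∣ N` in the half-index world from the Kummer values alone** (PROPOSITION A's first conclusion).  For an `X₀(N)`-datum with the lattice
clause, `Λ₁(f) ⊆ 2Λ₀(f)`, and THEOREM K's Kummer values `hKum`: the three rational `2`-torsion abscissae (`exists_three_hasRationalTwoTorsionX_of_kummerValues`)
are sorted and split over `ℂ`; the halving cocycle `κ₁` of `T₁` (LEAD D4) is odd at complex conjugation; every `2`-torsion point and every `R_y` is
fixed, so the Kummer subgroup `𝒱` of the cusp halves exists (LEAD); p2's abstract PROPOSITION A with the two vanishing inputs read through `hhalf`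
gives `2⁵ ∣ N`.  No printed fact. [cite: Stevens1989, §2] [cite: SilvermanAEC2009, Prop. X.1.4] -/
theorem two_pow_five_dvd_of_halfIndex_of_kummerValues (W₀ : WeierstrassCurve ℚ) [W₀.IsElliptic] {N : ℕ} [NeZero N]
    (D₀ : ModularParametrizationData W₀ N) (hopt : ∀ z ∈ D₀.L.lattice, ∃ w ∈ periodLattice D₀.f, z = D₀.c * w)
    (hhalf : ∀ z ∈ periodLatticeGamma1 D₀.f, ∃ w ∈ periodLattice D₀.f, z = 2 * w)
    (hKum : ∀ (σ : ℂ ≃ₐ[ℚ] ℂ) (d d' : ℤ), ((d * d' : ℤ) : ZMod N) = 1 →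
      σ (Complex.exp (2 * Real.pi * Complex.I / N)) = Complex.exp (2 * Real.pi * Complex.I * d / N) →
      ∀ (Q y : ℕ), Q * y = N → Nat.Coprime Q y → ∀ γ : Gamma0 N,
        (((γ : SL(2, ℤ)) 1 1 : ℤ) : ZMod Q) = (d' : ZMod Q) → (((γ : SL(2, ℤ)) 1 1 : ℤ) : ZMod y) = 1 →
        Affine.Point.map (W' := W₀) (σ : ℂ →ₐ[ℚ] ℂ) (D₀.uniformize ((D₀.c : ℂ) * modularSymbol D₀.f (1 / (y : ℚ)) / 2)) =
          D₀.uniformize ((D₀.c : ℂ) * modularSymbol D₀.f (1 / (y : ℚ)) / 2) +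
            D₀.uniformize ((D₀.c : ℂ) * cuspSymbol D₀.f γ / 2)) :
    2 ^ 5 ∣ N := by
  -- adapted from p2's `two_pow_five_dvd_and_hasFreyTwistShape_of_kummerValues` (gen 22; itself from the LEAD's p1 gen 20 assembly): the setup up to PROP A
  have hRfix := KummerDiamondIndexFourNoCES.map_atkinLehnerPoint_of_kummerValues W₀ D₀ hKum
  obtain ⟨x₁, x₂, x₃, h12, h13, h23, hx₁, hx₂, hx₃⟩ := exists_three_hasRationalTwoTorsionX_of_kummerValues D₀ hopt hKum
  obtain ⟨e₁, e₂, e₃, he₁₂, he₂₃, he₁, he₂, he₃⟩ := exists_sorted_twoTorsionX h12 h13 h23 hx₁ hx₂ hx₃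
  have he₁₃ : e₁ < e₃ := he₁₂.trans he₂₃
  have hsplit : W₀.toAffine.SplitTwoTorsion e₁ e₂ e₃ :=
    TwoTorsionNormalForm.splitTwoTorsion_of_three_twoTorsionX he₁₂.ne he₁₃.ne he₂₃.ne he₁ he₂ he₃
  have hC := HalvingCocycle.splitTwoTorsion_complex hsplit
  set T₁ : (W₀.baseChange ℂ).toAffine.Point := .some _ _ (nonsingular_twoTorsion hC) with hT₁
  have hT₁0 : T₁ ≠ 0 := Affine.Point.some_ne_zero _
  have h2T₁ : (2 : ℕ) • T₁ = 0 := by rw [two_nsmul]; exact twoTorsion_add_self hC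
  -- D4: the halving cocycle of `T₁`, odd at complex conjugation
  obtain ⟨Q₁, w₁, w₂, h2Q₁, hw₁, hw₂, hw₁0, hw₂0, htab₁⟩ := HalvingCocycle.exists_halvingCocycle_T₁ hC
  have h2Q₁' : 2 • Q₁ = T₁ := by rw [two_nsmul]; exact h2Q₁
  have h4Q₁ : 2 • (2 • Q₁) = 0 := by rw [h2Q₁']; exact h2T₁
  have hδ₁pos : (0 : ℚ) < (e₁ - e₂) * (e₁ - e₃) := mul_pos_of_neg_of_neg (by linarith) (by linarith)
  have hδ₂neg : e₁ - e₂ < (0 : ℚ) := by linarith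
  set κ₁ : (ℂ ≃ₐ[ℚ] ℂ) → (W₀.baseChange ℂ).toAffine.Point := fun σ ↦ Affine.Point.map (W' := W₀) (σ : ℂ →ₐ[ℚ] ℂ) Q₁ - Q₁ with hκ₁
  have hodd₁ : κ₁ (Complex.conjAe.restrictScalars ℚ) = T₁ := DescentDictionary.cocycle_conj_eq κ₁ hδ₁pos hδ₂neg hw₁ hw₂ htab₁
  -- every `2`-torsion point is fixed; the Kummer subgroup of the cusp halves
  have h2fix : ∀ S : (W₀.baseChange ℂ).toAffine.Point, 2 • S = 0 → ∀ σ : ℂ ≃ₐ[ℚ] ℂ,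
      Affine.Point.map (W' := W₀) (σ : ℂ →ₐ[ℚ] ℂ) S = S := fun S hS σ ↦ twoTorsion_fixed hC D₀ S hS σ
  obtain ⟨𝒱, h𝒱fin, h𝒱card, hmemR, hmem2⟩ := KummerSubgroup.exists_kummerSubgroup_cuspHalves_of_fixed D₀ h2fix hRfix
  -- PROPOSITION A (p2's abstract `StepTwo.propositionA`), its two vanishing inputs read through `hhalf`
  have hc : (Complex.conjAe.restrictScalars ℚ) (Complex.exp (2 * Real.pi * Complex.I / N)) =
      Complex.exp (2 * Real.pi * Complex.I * ((-1 : ℤ) : ℂ) / N) := StepTwo.conj_exp_two_pi_I_div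
  exact (StepTwo.propositionA (fun γ : Gamma0 N ↦ D₀.uniformize ((D₀.c : ℂ) * cuspSymbol D₀.f γ / 2))
    (fun (σ : ℂ ≃ₐ[ℚ] ℂ) (d : ℤ) ↦ σ (Complex.exp (2 * Real.pi * Complex.I / N)) = Complex.exp (2 * Real.pi * Complex.I * d / N))
    (Complex.conjAe.restrictScalars ℚ)
    (StepTwo.uniformize_half_cuspSymbol_mul D₀)
    (fun γ hγ ↦ uniformize_half_cuspSymbol_eq_zero_of_halfIndex D₀ hhalf (cuspSymbol_mem_periodLatticeGamma1_of_apply_eq_one _ γ hγ))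
    (StepTwo.uniformize_half_cuspSymbol_add_self D₀)
    (fun γ hγ ↦ uniformize_half_cuspSymbol_eq_zero_of_halfIndex D₀ hhalf (DiamondConductor.diamondCharacterConductorLaw_holds D₀.f γ hγ))
    (StepTwo.four_le_ncard_range_uniformize_half_cuspSymbol D₀ hopt) StepTwo.exists_inv_pair_of_algEquiv
    (fun d hd ↦ StepTwo.exists_algEquiv_exp_of_isCoprime hd) hc 𝒱 h𝒱fin h𝒱card
    (fun Q y hQy hcop ↦ ⟨_, hmemR Q y hQy hcop, fun σ d d' hdd' hσ γ hγQ hγy ↦ by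
      show Affine.Point.map (W' := W₀) (σ : ℂ →ₐ[ℚ] ℂ) (D₀.uniformize ((D₀.c : ℂ) * modularSymbol D₀.f (1 / (y : ℚ)) / 2)) -
          D₀.uniformize ((D₀.c : ℂ) * modularSymbol D₀.f (1 / (y : ℚ)) / 2) = D₀.uniformize ((D₀.c : ℂ) * cuspSymbol D₀.f γ / 2)
      rw [hKum σ d d' hdd' hσ Q y hQy hcop γ hγQ hγy, add_sub_cancel_left]⟩)
    ⟨κ₁, hmem2 Q₁ h4Q₁, by rw [hodd₁]; exact hT₁0⟩).1

/-! ## §2 E-es-187♭ and E-es-188♭ per datum, fact-free in the Kummer values -/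

/-- **E-es-187♭ per datum: half-index ∧ Kummer values ⟹ `2⁵ ∣ N` ∧ Frey-twist shape**, fact-free.  §1 gives `2⁵ ∣ N`, so `4 ∣ N` and Ling–Oesterlé's
`2Λ₀(f) ⊆ Λ₁(f)` (`two_mul_mem_periodLatticeGamma1_of_four_dvd`) make the half-index configuration the index-`4` one; then
`two_pow_five_dvd_and_hasFreyTwistShape_of_kummerValues'`.  (= es g40's E-es-187 «Steps 1–4 with `h4 ↦ hhalf`», with THEOREM K's conclusion as the
hypothesis.) [cite: Stevens1989, §2] [cite: LingOesterle1991, Thm. 2] [cite: SilvermanAEC2009, Prop. X.1.4] -/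
theorem two_pow_five_dvd_and_hasFreyTwistShape_of_halfIndex_of_kummerValues (W₀ : WeierstrassCurve ℚ) [W₀.IsElliptic] {N : ℕ} [NeZero N]
    (D₀ : ModularParametrizationData W₀ N) (hopt : ∀ z ∈ D₀.L.lattice, ∃ w ∈ periodLattice D₀.f, z = D₀.c * w)
    (hhalf : ∀ z ∈ periodLatticeGamma1 D₀.f, ∃ w ∈ periodLattice D₀.f, z = 2 * w)
    (hKum : ∀ (σ : ℂ ≃ₐ[ℚ] ℂ) (d d' : ℤ), ((d * d' : ℤ) : ZMod N) = 1 →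
      σ (Complex.exp (2 * Real.pi * Complex.I / N)) = Complex.exp (2 * Real.pi * Complex.I * d / N) →
      ∀ (Q y : ℕ), Q * y = N → Nat.Coprime Q y → ∀ γ : Gamma0 N,
        (((γ : SL(2, ℤ)) 1 1 : ℤ) : ZMod Q) = (d' : ZMod Q) → (((γ : SL(2, ℤ)) 1 1 : ℤ) : ZMod y) = 1 →
        Affine.Point.map (W' := W₀) (σ : ℂ →ₐ[ℚ] ℂ) (D₀.uniformize ((D₀.c : ℂ) * modularSymbol D₀.f (1 / (y : ℚ)) / 2)) =
          D₀.uniformize ((D₀.c : ℂ) * modularSymbol D₀.f (1 / (y : ℚ)) / 2) +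
            D₀.uniformize ((D₀.c : ℂ) * cuspSymbol D₀.f γ / 2)) :
    2 ^ 5 ∣ N ∧ HasFreyTwistShape W₀ := by
  have h32 := two_pow_five_dvd_of_halfIndex_of_kummerValues W₀ D₀ hopt hhalf hKum
  have hN4 : 2 ^ 2 ∣ N := (pow_dvd_pow 2 (by norm_num : 2 ≤ 5)).trans h32
  have h4 : ∀ z : ℂ, z ∈ periodLatticeGamma1 D₀.f ↔ ∃ w ∈ periodLattice D₀.f, z = 2 * w := fun z ↦
    ⟨hhalf z, fun ⟨w, hw, hz⟩ ↦ hz ▸ two_mul_mem_periodLatticeGamma1_of_four_dvd D₀ hN4 hw⟩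
  exact two_pow_five_dvd_and_hasFreyTwistShape_of_kummerValues' W₀ D₀ hopt h4 hKum

/-- **E-es-188♭ per datum: with modularity, NO lattice-optimal datum carrying THEOREM K's Kummer values is in the half-index world `Λ₁(f) ⊆ 2Λ₀(f)`**
(§2 gives `2⁵ ∣ N` and the Frey-twist shape; E-es-186♭ = Tate's family C at `2`, `FreyTwistConductor.freyTwistShapeTwoAdicLaw_holds_of_modularity`,
bounds the conductor exponent by `4`).  CONDITIONAL on modularity (`exists_isNewformOf`) and on `hKum`; desc g26's `Gamma1PeriodsNotInsideTwiceGamma0Periods`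
and es's E-es-188 follow BY NAME as soon as `hKum` is supplied in the half-index world (es g40 KDR½).  Nothing about BSD. [cite: Stevens1989, §2] -/
theorem not_halfIndex_of_modularity_of_kummerValues (hnf : exists_isNewformOf) (W₀ : WeierstrassCurve ℚ) [W₀.IsElliptic] {N : ℕ} [NeZero N]
    (D₀ : ModularParametrizationData W₀ N) (hopt : ∀ z ∈ D₀.L.lattice, ∃ w ∈ periodLattice D₀.f, z = D₀.c * w)
    (hhalf : ∀ z ∈ periodLatticeGamma1 D₀.f, ∃ w ∈ periodLattice D₀.f, z = 2 * w)
    (hKum : ∀ (σ : ℂ ≃ₐ[ℚ] ℂ) (d d' : ℤ), ((d * d' : ℤ) : ZMod N) = 1 →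
      σ (Complex.exp (2 * Real.pi * Complex.I / N)) = Complex.exp (2 * Real.pi * Complex.I * d / N) →
      ∀ (Q y : ℕ), Q * y = N → Nat.Coprime Q y → ∀ γ : Gamma0 N,
        (((γ : SL(2, ℤ)) 1 1 : ℤ) : ZMod Q) = (d' : ZMod Q) → (((γ : SL(2, ℤ)) 1 1 : ℤ) : ZMod y) = 1 →
        Affine.Point.map (W' := W₀) (σ : ℂ →ₐ[ℚ] ℂ) (D₀.uniformize ((D₀.c : ℂ) * modularSymbol D₀.f (1 / (y : ℚ)) / 2)) =
          D₀.uniformize ((D₀.c : ℂ) * modularSymbol D₀.f (1 / (y : ℚ)) / 2) +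
            D₀.uniformize ((D₀.c : ℂ) * cuspSymbol D₀.f γ / 2)) :
    False := by
  obtain ⟨h32, hshape⟩ := two_pow_five_dvd_and_hasFreyTwistShape_of_halfIndex_of_kummerValues W₀ D₀ hopt hhalf hKum
  exact FreyTwistConductor.freyTwistShapeTwoAdicLaw_holds_of_modularity hnf W₀ D₀ hshape h32

/-! ## §3 (APPEND, p3 gen 20) The Kummer values in the half-index world from T-es-75 ∧ CES — NO Shimura-cover fact

es g40's KDR½ carried a new statement-only input SC «the Shimura cover `π₁(c₁w) ↦ π₀(c₀w)` commutes with `Aut(ℂ/ℚ)`».  It is a THEOREM of the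
tree: for Néron-type period pairs of two curves over `ℚ` and `r ∈ ℚˣ` with `rΛ_{W₁} ⊆ Λ_{W₀}`, the analytic map `z ↦ rz` is the complex base
change of a `ℚ`-ISOGENY (`exists_isogeny_baseChange_apply_eq_of_forall_mul_mem_lattice`, Silverman VI.4.1 road, tree
`LatticeInclusion*Proofs`), and a `ℚ`-isogeny's base change commutes with every `σ ∈ Aut(ℂ/ℚ)` (`Isogeny.map_baseChange` with
`σ|_{ℚ̄} ∈ Γ_ℚ` by `AlgEquiv.restrictNormal`).  With CES's Stevens curve `W₁` (optimal `X₁(N)`-datum `D₁`, `Λ_{W₁} = c₁Λ₁(f)`) and the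
half-index hypothesis, `r = c₀/(2c₁)` satisfies `rΛ_{W₁} = (c₀/2)Λ₁(f) ⊆ c₀Λ₀(f) ⊆ Λ_{W₀}`; pushing THEOREM K♮ (es `kummerDiamondReciprocity`,
⟸ T-es-75) through this isogeny gives the Kummer values on `W₀` — for ANY `c₀` (odd or even), in the index-`4` world as well. -/

/-- **KDR½ ⟸ T-es-75 ∧ CES (no Shimura-cover fact): the Kummer values `σ(S_y) − S_y = π₀(c₀{∞,γ∞}_f/2)` in the half-index world
`Λ₁(f) ⊆ 2Λ₀(f)`, for every lattice-optimal `X₀(N)`-datum of a globally minimal curve (any `c₀`).**  Proof: Stevens' curve `W₁` (CES), THEOREM K♮ on it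
(es, ⟸ T-es-75), and the `ℚ`-isogeny `W₁ → W₀` attached to `(c₀/2c₁)·Λ_{W₁} ⊆ Λ_{W₀}` (tree), which is `Aut(ℂ/ℚ)`-equivariant on complex points.
CONDITIONAL on the two statement-only printed facts; nothing about BSD.
[cite: Stevens1982, §1.3 Thm. 1.3.1 (b)] [cite: ConradEdixhovenStein2003, §6.1 Lemma 6.1.6] [cite: SilvermanAEC2009, Thm. VI.4.1] -/
theorem halfIndex_kummerValues_of_Tes75_CES (hSt : optimalGamma1Parametrization_cuspInv_galoisAction)
    (hCES : exists_optimal_gamma1ParametrizationData) (W₀ : WeierstrassCurve ℚ) [W₀.IsElliptic] [W₀.IsGloballyMinimal]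
    {N : ℕ} [NeZero N] (D₀ : ModularParametrizationData W₀ N)
    (hopt : ∀ z ∈ D₀.L.lattice, ∃ w ∈ periodLattice D₀.f, z = D₀.c * w)
    (hhalf : ∀ z ∈ periodLatticeGamma1 D₀.f, ∃ w ∈ periodLattice D₀.f, z = 2 * w)
    (σ : ℂ ≃ₐ[ℚ] ℂ) (d d' : ℤ) (hdd' : ((d * d' : ℤ) : ZMod N) = 1)
    (hσ : σ (Complex.exp (2 * Real.pi * Complex.I / N)) = Complex.exp (2 * Real.pi * Complex.I * d / N))
    (Q y : ℕ) (hQy : Q * y = N) (hcop : Nat.Coprime Q y) (γ : Gamma0 N)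
    (hγQ : (((γ : SL(2, ℤ)) 1 1 : ℤ) : ZMod Q) = (d' : ZMod Q)) (hγy : (((γ : SL(2, ℤ)) 1 1 : ℤ) : ZMod y) = 1) :
    Affine.Point.map (W' := W₀) (σ : ℂ →ₐ[ℚ] ℂ) (D₀.uniformize ((D₀.c : ℂ) * modularSymbol D₀.f (1 / (y : ℚ)) / 2)) =
      D₀.uniformize ((D₀.c : ℂ) * modularSymbol D₀.f (1 / (y : ℚ)) / 2) +
        D₀.uniformize ((D₀.c : ℂ) * cuspSymbol D₀.f γ / 2) := by
  -- Stevens' curve and THEOREM K♮ on it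
  obtain ⟨W₁, _, _, D₁, hiso, hD₁⟩ := hCES W₀ D₀ hopt
  have hf : D₁.f = D₀.f := D₁.f_eq_of_isIsogenous D₀ hiso
  have hK := kummerDiamondReciprocity hSt W₁ D₁ hD₁ σ d d' hdd' hσ Q y hQy hcop γ hγQ hγy
  rw [hf] at hK
  -- the `ℚ`-isogeny `z ↦ r z`, `r = c₀/(2c₁)`
  have hc₁ : D₁.c ≠ 0 := D₁.maninConstant_ne_zero
  have hc₀ : D₀.c ≠ 0 := D₀.maninConstant_ne_zero_holds
  set r : ℚ := (D₀.c : ℚ) / (2 * (D₁.c : ℚ)) with hr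
  have hr0 : r ≠ 0 := by
    rw [hr]; exact div_ne_zero (by exact_mod_cast hc₀) (mul_ne_zero two_ne_zero (by exact_mod_cast hc₁))
  have hrc : (r : ℂ) * (D₁.c : ℂ) = (D₀.c : ℂ) / 2 := by
    have h1 : ((D₁.c : ℚ) : ℂ) ≠ 0 := by exact_mod_cast hc₁
    rw [hr]; push_cast; field_simp
  have hle : ∀ z ∈ D₁.L.lattice, (r : ℂ) * z ∈ D₀.L.lattice := by
    intro z hz
    obtain ⟨w, hw, hzw⟩ := hD₁ z hz
    rw [hf] at hw
    obtain ⟨v, hv, hwv⟩ := hhalf w hw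
    have e : (r : ℂ) * z = (D₀.c : ℂ) * v := by
      rw [hzw, hwv, ← mul_assoc, hrc]; ring
    rw [e]; exact D₀.smul_periodLattice_le v hv
  haveI : Algebra.IsAlgebraic ℚ (AlgebraicClosure ℚ) := AlgebraicClosure.isAlgebraic ℚ
  haveI : IsAlgClosure ℚ (AlgebraicClosure ℚ) := AlgebraicClosure.instIsAlgClosure ℚ
  haveI : Normal ℚ (AlgebraicClosure ℚ) := IsAlgClosure.normal ℚ (AlgebraicClosure ℚ)
  letI : Algebra (AlgebraicClosure ℚ) ℂ := (IsAlgClosed.lift : AlgebraicClosure ℚ →ₐ[ℚ] ℂ).toRingHom.toAlgebra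
  haveI : IsScalarTower ℚ (AlgebraicClosure ℚ) ℂ := IsScalarTower.of_algebraMap_eq' (Subsingleton.elim _ _)
  obtain ⟨ψ, hψ, -, -⟩ := exists_isogeny_baseChange_apply_eq_of_forall_mul_mem_lattice
    D₁.isNeronLattice.1 D₁.isNeronLattice.2 D₀.isNeronLattice.1 D₀.isNeronLattice.2
    D₁.ker_uniformize D₁.uniformize_surjective D₁.uniformize_spec D₀.ker_uniformize D₀.uniformize_spec hr0 hle
  -- `σ` restricted to `ℚ̄ ⊂ ℂ`, and the equivariance of `ψ_ℂ`
  set τ₀ : AlgebraicClosure ℚ ≃ₐ[ℚ] AlgebraicClosure ℚ := σ.restrictNormal (AlgebraicClosure ℚ) with hτ₀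
  have hστ : ∀ c : AlgebraicClosure ℚ, (σ : ℂ →ₐ[ℚ] ℂ) (algebraMap (AlgebraicClosure ℚ) ℂ c) =
      algebraMap (AlgebraicClosure ℚ) ℂ (Field.absoluteGaloisGroup.toAlgEquiv ℚ ((Field.absoluteGaloisGroup.toAlgEquiv ℚ).symm τ₀) c) := by
    intro c
    rw [MulEquiv.apply_symm_apply, hτ₀]
    exact (AlgEquiv.restrictNormal_commutes σ (AlgebraicClosure ℚ) c).symm
  have hequiv : ∀ P : (W₁.baseChange ℂ).toAffine.Point,
      Affine.Point.map (W' := W₀) (σ : ℂ →ₐ[ℚ] ℂ) (ψ.baseChange (M := ℂ) P) =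
        ψ.baseChange (M := ℂ) (Affine.Point.map (W' := W₁) (σ : ℂ →ₐ[ℚ] ℂ) P) :=
    fun P ↦ ψ.map_baseChange (σ : ℂ →ₐ[ℚ] ℂ) ((Field.absoluteGaloisGroup.toAlgEquiv ℚ).symm τ₀) hστ P
  -- push THEOREM K♮ through `ψ_ℂ`
  have hK' := congrArg (ψ.baseChange (M := ℂ)) hK
  rw [← hequiv, map_add, hψ, hψ] at hK'
  have e1 : (r : ℂ) * ((D₁.c : ℂ) * modularSymbol D₀.f (1 / (y : ℚ))) = (D₀.c : ℂ) * modularSymbol D₀.f (1 / (y : ℚ)) / 2 := by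
    rw [← mul_assoc, hrc]; ring
  have e2 : (r : ℂ) * ((D₁.c : ℂ) * cuspSymbol D₀.f γ) = (D₀.c : ℂ) * cuspSymbol D₀.f γ / 2 := by
    rw [← mul_assoc, hrc]; ring
  rw [e1, e2] at hK'
  exact hK'

/-- **E-es-187 per datum ⟸ CES ∧ T-es-75**: in the half-index world a lattice-optimal datum of a globally minimal curve has `2⁵ ∣ N` and the
Frey-twist shape (§3 Kummer values into §2).  CONDITIONAL on two printed facts; nothing about BSD.
[cite: Stevens1982, §1.3 Thm. 1.3.1 (b)] [cite: ConradEdixhovenStein2003, §6.1 Lemma 6.1.6] [cite: Stevens1989, §2] -/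
theorem two_pow_five_dvd_and_hasFreyTwistShape_of_halfIndex_of_CES_Tes75 (hCES : exists_optimal_gamma1ParametrizationData)
    (hSt : optimalGamma1Parametrization_cuspInv_galoisAction) (W₀ : WeierstrassCurve ℚ) [W₀.IsElliptic] [W₀.IsGloballyMinimal]
    {N : ℕ} [NeZero N] (D₀ : ModularParametrizationData W₀ N)
    (hopt : ∀ z ∈ D₀.L.lattice, ∃ w ∈ periodLattice D₀.f, z = D₀.c * w)
    (hhalf : ∀ z ∈ periodLatticeGamma1 D₀.f, ∃ w ∈ periodLattice D₀.f, z = 2 * w) :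
    2 ^ 5 ∣ N ∧ HasFreyTwistShape W₀ :=
  two_pow_five_dvd_and_hasFreyTwistShape_of_halfIndex_of_kummerValues W₀ D₀ hopt hhalf
    (halfIndex_kummerValues_of_Tes75_CES hSt hCES W₀ D₀ hopt hhalf)

/-- **E-es-188 per datum ⟸ modularity ∧ CES ∧ T-es-75: `Λ₁(f) ⊄ 2Λ₀(f)` for every lattice-optimal `X₀(N)`-datum of a globally minimal curve**
(the `2`-part of Stevens' cyclicity `Λ₀(f)/Λ₁(f)` cyclic on the lattice-optimal member; print has it only «étale at least over `ℤ[1/2]`»,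
Vatsal 2005 p. 15, per es g40 §61).  CONDITIONAL on three statement-only printed facts (modularity `exists_isNewformOf`, Conrad–Edixhoven–Stein
2003 / Stevens 1989 = CES, Stevens 1982 Thm 1.3.1 (b) = T-es-75); Manin's conjecture and BSD are not proved by this.
[cite: Stevens1982, §1.3 Thm. 1.3.1 (b)] [cite: ConradEdixhovenStein2003, §6.1 Lemma 6.1.6] [cite: Stevens1989, §2] [cite: Vatsal2005, Thm. 1.10] -/
theorem not_halfIndex_of_modularity_CES_Tes75 (hnf : exists_isNewformOf) (hCES : exists_optimal_gamma1ParametrizationData)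
    (hSt : optimalGamma1Parametrization_cuspInv_galoisAction) (W₀ : WeierstrassCurve ℚ) [W₀.IsElliptic] [W₀.IsGloballyMinimal]
    {N : ℕ} [NeZero N] (D₀ : ModularParametrizationData W₀ N)
    (hopt : ∀ z ∈ D₀.L.lattice, ∃ w ∈ periodLattice D₀.f, z = D₀.c * w) :
    ¬ (∀ z ∈ periodLatticeGamma1 D₀.f, ∃ w ∈ periodLattice D₀.f, z = 2 * w) := fun hhalf ↦
  not_halfIndex_of_modularity_of_kummerValues hnf W₀ D₀ hopt hhalf (halfIndex_kummerValues_of_Tes75_CES hSt hCES W₀ D₀ hopt hhalf)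

/-! ## §4 (APPEND, p3 gen 20) No prime `p` with `Λ₁(f) ⊆ pΛ₀(f)`: Stevens' cyclicity of `Λ₀(f)/Λ₁(f)` on the lattice-optimal member

`Λ₀(f)/Λ₁(f)` (≅ the kernel of the Stevens isogeny `E₁ → E₀`, Cartier dual to `E₀ ∩ Σ(N)`) is CYCLIC iff no prime `p` has `Λ₁(f) ⊆ pΛ₀(f)`.
Odd `p`: fact-free — complex conjugation acts trivially on `Λ₀/Λ₁` (LEAD p1 gen 14 `conj_sub_self_mem_periodLatticeGamma1`, whose transport
`conj_sub_self_mem_natCast_mul_of_index` only ever used the inclusion `Λ₁ ⊆ pΛ₀`) but has trace `−2` on `Λ_{E₀}`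
(`false_of_conj_sub_self_mem_natCast_mul`).  `p = 2`: §3 (⟸ modularity ∧ CES ∧ T-es-75).  So, modulo those three statement-only printed facts,
**no prime `p` has `Λ₁(f) ⊆ pΛ₀(f)` for a lattice-optimal `X₀(N)`-datum of a globally minimal curve** — desc g26's `ShimuraKernelCyclic` /
an's «Stevens cyclicity» on the lattice-optimal member, in the prime-by-prime currency. -/

/-- **`Λ₁(f) ⊄ pΛ₀(f)` for every `p ≥ 3`** (lattice-optimal `X₀(N)`-datum; fact-free; the inclusion form of LEAD p1 gen 14's
`not_periodLatticeGamma1_eq_natCast_mul_periodLattice`, whose proof used only `Λ₁ ⊆ pΛ₀`). [cite: Stevens1989, §2] [cite: Manin1972, §1.6] -/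
theorem not_periodLatticeGamma1_le_natCast_mul_periodLattice {W₀ : WeierstrassCurve ℚ} {N : ℕ} [NeZero N]
    (D₀ : ModularParametrizationData W₀ N) (hopt : ∀ z ∈ D₀.L.lattice, ∃ w ∈ periodLattice D₀.f, z = D₀.c * w) {p : ℕ} (hp : 3 ≤ p) :
    ¬ (∀ z ∈ periodLatticeGamma1 D₀.f, ∃ w ∈ periodLattice D₀.f, z = (p : ℂ) * w) := by
  intro hle
  refine false_of_conj_sub_self_mem_natCast_mul D₀.L hp fun z hz ↦ ?_
  -- adapted from `conj_sub_self_mem_natCast_mul_of_index` (LEAD p1 gen 14), reading `(hidx _).mp` as `hle`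
  have hreal : ∀ n, (cuspCoeff D₀.f n).im = 0 := D₀.isNewformOf.1.cuspCoeff_im_eq_zero
  obtain ⟨w, hw, rfl⟩ := hopt z hz
  obtain ⟨w', hw', hww'⟩ := hle _ (conj_sub_self_mem_periodLatticeGamma1 hreal hw)
  refine ⟨D₀.c * w', D₀.smul_periodLattice_le w' hw', ?_⟩
  rw [map_mul, map_intCast, ← mul_sub, hww']; ring

/-- **No prime `p` with `Λ₁(f) ⊆ pΛ₀(f)` — the kernel of the Stevens isogeny is CYCLIC on the lattice-optimal member — modulo
modularity ∧ CES ∧ T-es-75** (`p = 2`: §3 `not_halfIndex_of_modularity_CES_Tes75`; `p ≥ 3`: fact-free, above).  CONDITIONAL on three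
statement-only printed facts; Manin's conjecture and BSD are not proved by this.
[cite: Stevens1989, §2] [cite: Stevens1982, §1.3 Thm. 1.3.1 (b)] [cite: ConradEdixhovenStein2003, §6.1 Lemma 6.1.6] [cite: Vatsal2005, Thm. 1.10] -/
theorem not_periodLatticeGamma1_le_prime_mul_of_modularity_CES_Tes75 (hnf : exists_isNewformOf)
    (hCES : exists_optimal_gamma1ParametrizationData) (hSt : optimalGamma1Parametrization_cuspInv_galoisAction)
    (W₀ : WeierstrassCurve ℚ) [W₀.IsElliptic] [W₀.IsGloballyMinimal] {N : ℕ} [NeZero N] (D₀ : ModularParametrizationData W₀ N)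
    (hopt : ∀ z ∈ D₀.L.lattice, ∃ w ∈ periodLattice D₀.f, z = D₀.c * w) {p : ℕ} (hp : p.Prime) :
    ¬ (∀ z ∈ periodLatticeGamma1 D₀.f, ∃ w ∈ periodLattice D₀.f, z = (p : ℂ) * w) := by
  rcases hp.eq_two_or_odd' with rfl | hodd
  · exact_mod_cast not_halfIndex_of_modularity_CES_Tes75 hnf hCES hSt W₀ D₀ hopt
  · obtain ⟨k, hk⟩ := hodd
    exact not_periodLatticeGamma1_le_natCast_mul_periodLattice D₀ hopt (by have := hp.two_le; omega)

/-! ## §5 (APPEND, p3 gen 20) The odd part is `f`-ONLY: `Λ₁(f) ⊄ pΛ₀(f)` for every rational newform and every `p ≥ 3` — no curve, no datum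

The transport through a Néron lattice in §4 is unnecessary: `Λ₀(f)` itself is a lattice for a newform with coefficient field `ℚ`
(`IsNewform0.exists_periodPair_of_coeffField_eq_bot`, Shimura Thm. 7.14 in the tree), conjugation maps `Λ₀(f)` to itself with `z̄ − z ∈ Λ₁(f)`
(`conj_sub_self_mem_periodLatticeGamma1`), and `z ↦ z̄ − z` has trace `−2` (`false_of_conj_sub_self_mem_natCast_mul`).  This is the ODD PART of
desc g26's `f`-only row `NewformShimuraKernelCyclic` (E-desc-g26-2♮), fact-free; the `2`-part is §3 (on the lattice-optimal member, three facts). -/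

/-- **For every newform `f ∈ S₂(Γ₀(N))` with rational coefficients and every `p ≥ 3`: `Λ₁(f) ⊄ pΛ₀(f)`** — `f`-only, fact-free
(the odd part of the cyclicity of `Λ₀(f)/Λ₁(f)`). [cite: Stevens1989, §2] [cite: Manin1972, §1.6] [cite: ShimuraIATAF1971, Thm. 7.14] -/
theorem not_periodLatticeGamma1_le_natCast_mul_of_isNewform0 {N : ℕ} [NeZero N] {f : CuspForm (Gamma0 N) 2}
    (hf : IsNewform0 f) (hQ : coeffField f = ⊥) {p : ℕ} (hp : 3 ≤ p) :
    ¬ (∀ z ∈ periodLatticeGamma1 f, ∃ w ∈ periodLattice f, z = (p : ℂ) * w) := by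
  intro hle
  obtain ⟨L, hL⟩ := hf.exists_periodPair_of_coeffField_eq_bot hQ
  have hmem : ∀ x, x ∈ L.lattice ↔ x ∈ periodLattice f := fun x ↦ by rw [← hL]; rfl
  refine false_of_conj_sub_self_mem_natCast_mul L hp fun z hz ↦ ?_
  obtain ⟨w, hw, hww⟩ := hle _ (conj_sub_self_mem_periodLatticeGamma1 hf.cuspCoeff_im_eq_zero ((hmem z).mp hz))
  exact ⟨w, (hmem w).mpr hw, hww⟩

/-- **`Λ₁(f) ⊄ pΛ₀(f)`, `p ≥ 3`, for the newform of ANY `X₀(N)`-datum** (no lattice clause, no minimality; §4's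
`not_periodLatticeGamma1_le_natCast_mul_periodLattice` without `hopt`). Fact-free. [cite: Stevens1989, §2] [cite: Manin1972, §1.6] -/
theorem not_periodLatticeGamma1_le_natCast_mul {W₀ : WeierstrassCurve ℚ} {N : ℕ} [NeZero N]
    (D₀ : ModularParametrizationData W₀ N) {p : ℕ} (hp : 3 ≤ p) :
    ¬ (∀ z ∈ periodLatticeGamma1 D₀.f, ∃ w ∈ periodLattice D₀.f, z = (p : ℂ) * w) :=
  not_periodLatticeGamma1_le_natCast_mul_of_isNewform0 D₀.isNewformOf.1 D₀.isNewformOf.coeffField_eq_bot hp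

end Summit.BirchSwinnertonDyer.BirchSwinnertonDyer.Theorems.ManinLocalTwoThree.KummerValues

end
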